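import Summits.BirchSwinnertonDyer.BirchSwinnertonDyer.Theorems.ResidualThetaTransportAtTwoResidualSignedLambdaLowerCMAtTwoAwayKernelTransitions
import Summits.BirchSwinnertonDyer.BirchSwinnertonDyer.Theorems.ResidualThetaTransportAtTwoResidualSignedLambdaLowerCMAtTwoRhoLayerPairingProjectionAwayTwo
import Summits.BirchSwinnertonDyer.BirchSwinnertonDyer.Theorems.ResidualThetaTransportAtTwoResidualSignedLambdaLowerCMAtTwoCofreeReductionLimit
import Summits.BirchSwinnertonDyer.BirchSwinnertonDyer.Theorems.ResidualThetaTransportAtTwoResidualSignedLambdaLowerCMAtTwoDeepHalfAwayTwoCharacterReadback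
import HarnessLib

/-!
# GLUE package T2 (b), third part: the S₀-side VALUE CHARACTER of a class `x ∈ 𝐇¹_Γ(T_ρ)` at `(w, σ)` — the level characters
# `y ↦ ⟨red_{2^k}(conj_σ proj_m x), y⟩_{m,2^k,w} · 2^{-k}` on `H¹(U_{m,w}, A_ρ[2^k]|)` glue to ONE character of `D_w = H¹(ℚ_{∞,w̃}, A_ρ)`

Route `ResidualThetaTransportAtTwo` (RTT), crux RSL_g `ResidualSignedLambdaLowerCMAtTwo` (stmt-BirchSwinnertonDyer-22608), line «onepair»; LEAD
`prover-bsd-wall-rtt-p2` g19 (`--supports 22608 --as helper`, closes nothing). ONE definition with body (`awayLevelChar`, the prescribed level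
value character — named so that each prescribed value elaborates once) + theorems; no named fact, no instance, no notation, no `sorry`. BSD is not proved by any of this; RSL_g (22608) stays OPEN.

WHY (GLUE-SPEC-g18 §1 T2 (b); `AwayPins.hlocdS` of `…AwayDefs`). The pin bundle `AwayPins π` wants `locdS x w c : CharacterModule (Dloc w)`
whose value on `jAway w m k y` (`m ≥ n_w`) is `⟨red_{2^k}(conj_{c.out} proj_m x), y⟩_{m,2^k} · 2^{-k}`. This file proves that such a character
EXISTS and is UNIQUE, for every `x`, `w ∤ 2` and `σ ∈ Γ_ℚ`, by the direct-limit universal property of `D_w` assembled in the two previous files: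
exhaustion (`ProfiniteExhaustion.exists_jAway_eq_from`, w2 p700479), the transitions `tAway` with `j ∘ t = j` and the kernel criterion
(`…AwayKernelTransitions`), and the character glue (`AwayKernel.exists_addMonoidHom_of_directed`, p705480), over the directed set `ℕ × ℕ`
(`(i, k) ↦` layer `n_w + i`, level `2^k`). The compatibility of the level values along the transitions is (n-direction) the projection formula
above the floor `ThetaTransport.rhoAwayPairingPk_conj_proj_of_le` (p696153) and (k-direction) the MIXED PROJECTION FORMULA
`⟨[2]_* b, y⟩_{2^k} · 2^{-k} = ⟨b, ι_* y⟩_{2^{k+1}} · 2^{-(k+1)}`, taken here as the HYPOTHESIS `hK` in the currency of tp2-p2x's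
`cofreeTorsionLocalPow` / `cofreeTorsionLocalIncl` (their `…DeepHalfAwayTwoTowerPow`, announced 07:28Z, discharges it; it holds for the self-dual
tower `ePk` with `ζ_{k+1}² = ζ_k`), combined with `[2]_* red_{2^{k+1}} = red_{2^k}` (`cohomologyMap_cofreeTorsionPow_reduceH1CofreePkTorsion_succ`)
and the naturality of `loc` in the coefficients (`layerLocOf_cohomologyMap`).

* §1 `val_add_smul_of_nsmul_eq_zero`, `two_pow_nsmul_inv_two_pow` — the `ℚ/ℤ`-reading `t ↦ t.val • 2^{-k}` of `ℤ/2^k` is additive.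
* §2 `awayLevelChar` (the level value character, a definition with body) + `_apply`, `_tAway_left/_succ/_right`, `awayLevelChar_tAway`,
  `awayLevelChar_add`; `exists_awayCharacter` — existence of the glued character; `awayCharacter_unique` — uniqueness (exhaustion).

References: [SerreGaloisCohomology1997] I §2.2 Prop. 8; [Kato2004Asterisque] §13.8 (pp. 228–229), §17.13; [PerrinRiou1994Invent] §3.6.1;
[GreenbergVatsal2000] §2 Prop. 2.4.
-/

set_option autoImplicit false
-- the Theorems namespace of this sub repeats the summit name by design (D-0017 nested layout)
set_option linter.dupNamespace false

noncomputable section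

open scoped Classical
open CategoryTheory Topology Field NumberField IsDedekindDomain
open Literature.NumberTheory.GaloisRepresentations Literature.NumberTheory.EllipticCurves
open Literature.NumberTheory.EllipticCurves.GreenbergSelmer Literature.NumberTheory.EllipticCurves.CyclotomicLayer
open Literature.NumberTheory.EllipticCurves.Kato2004

namespace Summit.BirchSwinnertonDyer.BirchSwinnertonDyer.Theorems.ThetaTransport

/-! ## §1 The `ℚ/ℤ`-reading of `ℤ/N` is additive -/

/-- `(a + b).val • u = a.val • u + b.val • u` for an `N`-torsion element `u` (the reading `t ↦ t.val • N⁻¹` of `ℤ/N` in `ℚ/ℤ` is additive).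
[cite: Kato2004Asterisque, §17.13 (p. 279)] -/
theorem val_add_smul_of_nsmul_eq_zero {N : ℕ} [NeZero N] {A : Type*} [AddCommGroup A] (u : A) (hu : N • u = 0) (a b : ZMod N) :
    (a + b).val • u = a.val • u + b.val • u := by
  have h : (a.val + b.val) • u = ((a.val + b.val) % N) • u := by
    conv_lhs => rw [← Nat.mod_add_div (a.val + b.val) N]
    rw [add_nsmul, mul_nsmul, hu, smul_zero, add_zero]
  rw [ZMod.val_add, ← h, add_nsmul]

/-- `2^k • 2^{-k} = 0` in `ℚ/ℤ`. [cite: Kato2004Asterisque, §17.13 (p. 279)] -/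
theorem two_pow_nsmul_inv_two_pow (k : ℕ) : (2 ^ k : ℕ) • ((((2 : ℚ) ^ k)⁻¹ : ℚ) : AddCircle (1 : ℚ)) = 0 := by
  haveI : NeZero (2 ^ k) := ⟨pow_ne_zero k two_ne_zero⟩
  have h := addOrderOf_nsmul_eq_zero (((((2 ^ k : ℕ) : ℚ))⁻¹ : ℚ) : AddCircle (1 : ℚ))
  rw [AwayCharacterReadback.addOrderOf_inv_natCast] at h
  rwa [AwayCharacterReadback.inv_natCast_two_pow] at h

/-! ## §2 The glued S₀-side value character of `x` at `(w, σ)` -/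

section Glue

variable (S : Set (PadicAlgCl 2)) (ρ : FramedGaloisRep ℚ ↥(padicCoeffIntegers S) 2)
  (ePk : ∀ k : ℕ, ↥(AddSubgroup.torsionBy (Cofree ρ ↥(padicCoeffField S)) ((2 ^ k : ℕ) : ℤ)) →
    ↥(AddSubgroup.torsionBy (Cofree ρ ↥(padicCoeffField S)) ((2 ^ k : ℕ) : ℤ)) → AlgebraicClosure ℚ)
  (hμPk : ∀ k a b, ePk k a b ^ (2 ^ k) = 1)
  (hadd₁Pk : ∀ k a₁ a₂ b, ePk k (a₁ + a₂) b = ePk k a₁ b * ePk k a₂ b)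
  (hadd₂Pk : ∀ k a b₁ b₂, ePk k a (b₁ + b₂) = ePk k a b₁ * ePk k a b₂)
  (hgalPk : ∀ k (σ : absoluteGaloisGroup ℚ) (a b : ↥(AddSubgroup.torsionBy (Cofree ρ ↥(padicCoeffField S)) ((2 ^ k : ℕ) : ℤ))),
    σ • ePk k a b = ePk k (cofreeTorsionGaloisModule S ρ _ σ a) (cofreeTorsionGaloisModule S ρ _ σ b))
  (κ : ZpExtension ℚ 2) (hκ : κ.IsCyclotomic) (w : HeightOneSpectrum (𝓞 ℚ)) (hw : ((2 : ℕ) : 𝓞 ℚ) ∉ w.asIdeal)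
  {γ : absoluteGaloisGroup ℚ} (I : IwasawaH1DataCoeff (FramedGaloisRep.toGaloisRep ρ) 2 κ γ)
  -- (K): the mixed projection formula `⟨[2]_* b, y⟩_{2^k} · 2^{-k} = ⟨b, ι_* y⟩_{2^{k+1}} · 2^{-(k+1)}` at `w`, above the floor
  (hK : ∀ (m : ℕ), OnePair.nfl w ≤ m → ∀ (k : ℕ)
    (b : continuousCohomology 1 (subgroupRep (localRepOf (cofreeTorsionGaloisModule S ρ ((2 ^ (k + 1) : ℕ) : ℤ)) w) (layerGroup κ w m)))
    (y : OnePair.Dlev S κ ρ w m k),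
    (layerPairingH1Of (cofreeTorsionGaloisModule S ρ ((2 ^ k : ℕ) : ℤ)) (2 ^ k) (ePk k) (hμPk k) (hadd₁Pk k) (hadd₂Pk k) (hgalPk k) κ w m
        (cohomologyMap (subgroupRepMap (Y := localRepOf (cofreeTorsionGaloisModule S ρ ((2 ^ k : ℕ) : ℤ)) w)
          (cofreeTorsionLocalPow S ρ k w) (layerGroup κ w m)) 1 b) y).val • ((((2 : ℚ) ^ k)⁻¹ : ℚ) : AddCircle (1 : ℚ)) =
      (layerPairingH1Of (cofreeTorsionGaloisModule S ρ ((2 ^ (k + 1) : ℕ) : ℤ)) (2 ^ (k + 1)) (ePk (k + 1)) (hμPk (k + 1))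
          (hadd₁Pk (k + 1)) (hadd₂Pk (k + 1)) (hgalPk (k + 1)) κ w m b
        (cohomologyMap (subgroupRepMap (Y := localRepOf (cofreeTorsionGaloisModule S ρ ((2 ^ (k + 1) : ℕ) : ℤ)) w)
          (cofreeTorsionLocalIncl S ρ k w) (layerGroup κ w m)) 1 y)).val • ((((2 : ℚ) ^ (k + 1))⁻¹ : ℚ) : AddCircle (1 : ℚ)))

/-! ### The level value characters -/

/-- **The level value character of `x` at `(w, σ; m, k)`**: `y ↦ ⟨red_{2^k}(conj_σ proj_m x), y⟩_{m,2^k,w} · 2^{-k} ∈ ℚ/ℤ` on `H¹(U_{m,w}, A_ρ[2^k]|)` —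
the value prescribed by `AwayPins.hlocdS` on the image of `j_{m,k}` (additive in `y`: the layer pairing is additive and `t ↦ t.val • 2^{-k}` is additive
on `ℤ/2^k`). A definition with body (so that the glue below elaborates each prescribed value ONCE). [cite: PerrinRiou1994Invent, §3.6.1]
[cite: Kato2004Asterisque, §13.8 (pp. 228–229)] -/
def awayLevelChar (x : I.H) (σ : absoluteGaloisGroup ℚ) (m k : ℕ) : OnePair.Dlev S κ ρ w m k →+ AddCircle (1 : ℚ) :=
  AddMonoidHom.mk'
    (fun y ↦ (layerPairingOf (cofreeTorsionGaloisModule S ρ ((2 ^ k : ℕ) : ℤ)) (2 ^ k) (ePk k) (hμPk k) (hadd₁Pk k) (hadd₂Pk k) (hgalPk k) κ w m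
      (reduceH1CofreePkTorsion S ρ k (κ.layerSubgroup m)
        (conjMap (FramedGaloisRep.toGaloisRep ρ).toTopRep (κ.layerSubgroup m) σ 1 (I.proj m x))) y).val •
      ((((2 : ℚ) ^ k)⁻¹ : ℚ) : AddCircle (1 : ℚ)))
    fun y y' ↦ by
      haveI : NeZero (2 ^ k) := ⟨pow_ne_zero k two_ne_zero⟩
      rw [map_add]
      exact val_add_smul_of_nsmul_eq_zero _ (two_pow_nsmul_inv_two_pow k) _ _

/-- Unfolding `awayLevelChar` (definitional). [cite: PerrinRiou1994Invent, §3.6.1] -/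
theorem awayLevelChar_apply (x : I.H) (σ : absoluteGaloisGroup ℚ) (m k : ℕ) (y : OnePair.Dlev S κ ρ w m k) :
    awayLevelChar S ρ ePk hμPk hadd₁Pk hadd₂Pk hgalPk κ w I x σ m k y =
      (layerPairingOf (cofreeTorsionGaloisModule S ρ ((2 ^ k : ℕ) : ℤ)) (2 ^ k) (ePk k) (hμPk k) (hadd₁Pk k) (hadd₂Pk k) (hgalPk k) κ w m
        (reduceH1CofreePkTorsion S ρ k (κ.layerSubgroup m)
          (conjMap (FramedGaloisRep.toGaloisRep ρ).toTopRep (κ.layerSubgroup m) σ 1 (I.proj m x))) y).val •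
        ((((2 : ℚ) ^ k)⁻¹ : ℚ) : AddCircle (1 : ℚ)) :=
  rfl

include hκ hw in
set_option maxHeartbeats 800000 in
-- the dialect bridge `subgroupH1 U ↥A_ρ[2^k] = H1 (cofreeTorsionGaloisModule …) U` is slow to unify under `rw` (as in p696153 / p679036)
/-- **Compatibility along the layers** (`m ≤ m'`, fixed `k`, `m ≥ n_w`): the projection formula above the floor (p696153).
[cite: Kato2004Asterisque, §12.2 (p. 220)] [cite: PerrinRiou1994Invent, §3.6.1] -/
theorem awayLevelChar_tAway_left (x : I.H) (σ : absoluteGaloisGroup ℚ) {m m' : ℕ} (hm : OnePair.nfl w ≤ m) (h : m ≤ m') (k : ℕ)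
    (y : OnePair.Dlev S κ ρ w m k) :
    awayLevelChar S ρ ePk hμPk hadd₁Pk hadd₂Pk hgalPk κ w I x σ m' k (OnePair.tAway S κ ρ w h (le_refl k) y) =
      awayLevelChar S ρ ePk hμPk hadd₁Pk hadd₂Pk hgalPk κ w I x σ m k y := by
  rw [awayLevelChar_apply, awayLevelChar_apply, OnePair.tAway_left,
    ← rhoAwayPairingPk_conj_proj_of_le S ρ ePk hμPk hadd₁Pk hadd₂Pk hgalPk κ hκ w hw I σ hm k x y h]

include hK in
set_option maxHeartbeats 800000 in
-- as above
/-- **Compatibility along the levels, one step** (`k ≤ k + 1`, fixed `m ≥ n_w`): the mixed projection formula (K) with `[2]_* red_{2^{k+1}} = red_{2^k}`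
and the naturality of `loc` in the coefficients. [cite: Kato2004Asterisque, §13.8 (pp. 228–229)] [cite: PerrinRiou1994Invent, §3.6.1] -/
theorem awayLevelChar_tAway_succ (x : I.H) (σ : absoluteGaloisGroup ℚ) {m : ℕ} (hm : OnePair.nfl w ≤ m) (k : ℕ)
    (y : OnePair.Dlev S κ ρ w m k) :
    awayLevelChar S ρ ePk hμPk hadd₁Pk hadd₂Pk hgalPk κ w I x σ m (k + 1) (OnePair.tAway S κ ρ w (le_refl m) (Nat.le_succ k) y) =
      awayLevelChar S ρ ePk hμPk hadd₁Pk hadd₂Pk hgalPk κ w I x σ m k y := by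
  rw [awayLevelChar_apply, awayLevelChar_apply, OnePair.tAway_succ_right, layerPairingOf_apply, layerPairingOf_apply, ← hK m hm k,
    ← cohomologyMap_cofreeTorsionPow_reduceH1CofreePkTorsion_succ S ρ k (κ.layerSubgroup m), layerLocOf_cohomologyMap]
  rfl

include hK in
/-- **Compatibility along the levels** (`k ≤ K`, fixed `m ≥ n_w`), by induction on `K`. [cite: Kato2004Asterisque, §13.8 (pp. 228–229)] -/
theorem awayLevelChar_tAway_right (x : I.H) (σ : absoluteGaloisGroup ℚ) {m : ℕ} (hm : OnePair.nfl w ≤ m) (K : ℕ) :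
    ∀ (k : ℕ) (h : k ≤ K) (y : OnePair.Dlev S κ ρ w m k),
      awayLevelChar S ρ ePk hμPk hadd₁Pk hadd₂Pk hgalPk κ w I x σ m K (OnePair.tAway S κ ρ w (le_refl m) h y) =
        awayLevelChar S ρ ePk hμPk hadd₁Pk hadd₂Pk hgalPk κ w I x σ m k y := by
  induction K with
  | zero =>
    intro k h y
    obtain rfl : k = 0 := Nat.le_zero.mp h
    rw [OnePair.tAway_refl]
  | succ K ih =>
    intro k h y
    rcases Nat.lt_or_eq_of_le h with hlt | rfl
    · have h' : k ≤ K := Nat.lt_succ_iff.mp hlt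
      rw [← OnePair.tAway_tAway S κ ρ w (le_refl m) (le_refl m) h' (Nat.le_succ K),
        awayLevelChar_tAway_succ S ρ ePk hμPk hadd₁Pk hadd₂Pk hgalPk κ w I hK x σ hm K, ih k h']
    · rw [OnePair.tAway_refl]

include hκ hw hK in
/-- **Compatibility along every transition** `(m, k) ≤ (m', K)` from the floor. [cite: Kato2004Asterisque, §13.8 (pp. 228–229)] -/
theorem awayLevelChar_tAway (x : I.H) (σ : absoluteGaloisGroup ℚ) {m m' k K : ℕ} (hm : OnePair.nfl w ≤ m) (h : m ≤ m') (h' : k ≤ K)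
    (y : OnePair.Dlev S κ ρ w m k) :
    awayLevelChar S ρ ePk hμPk hadd₁Pk hadd₂Pk hgalPk κ w I x σ m' K (OnePair.tAway S κ ρ w h h' y) =
      awayLevelChar S ρ ePk hμPk hadd₁Pk hadd₂Pk hgalPk κ w I x σ m k y := by
  rw [← OnePair.tAway_tAway S κ ρ w h (le_refl m') (le_refl k) h',
    awayLevelChar_tAway_right S ρ ePk hμPk hadd₁Pk hadd₂Pk hgalPk κ w I hK x σ (hm.trans h) K k h',
    awayLevelChar_tAway_left S ρ ePk hμPk hadd₁Pk hadd₂Pk hgalPk κ hκ w hw I x σ hm h k y]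

/-! ### The glue -/

include hκ hw hK in
/-- **The glued S₀-side value character.** For `x ∈ 𝐇¹_Γ(T_ρ)`, an odd place `w` and `σ ∈ Γ_ℚ` there is an additive `Χ : D_w → ℚ/ℤ` whose value
on `j_{m,k} y` (`m ≥ n_w`, `y ∈ H¹(U_{m,w}, A_ρ[2^k]|)`) is `⟨red_{2^k}(conj_σ proj_m x), y⟩_{m,2^k,w} · 2^{-k}` — the value prescribed by
`AwayPins.hlocdS` (with `σ = c.out`). Direct-limit universal property of `D_w = lim→ H¹(U_{m,w}, A_ρ[2^k]|)` over `ℕ × ℕ`: exhaustion (w2 p700479),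
transitions + kernel criterion (`…AwayKernelTransitions`), character glue (p705480); compatibility of the level values = `awayLevelChar_tAway`.
[cite: SerreGaloisCohomology1997, I §2.2 Prop. 8] [cite: Kato2004Asterisque, §13.8 (pp. 228–229)] [cite: PerrinRiou1994Invent, §3.6.1] -/
theorem exists_awayCharacter (x : I.H) (σ : absoluteGaloisGroup ℚ) :
    ∃ Χ : OnePair.Dloc S κ ρ w →+ AddCircle (1 : ℚ), ∀ (m : ℕ), OnePair.nfl w ≤ m → ∀ (k : ℕ) (y : OnePair.Dlev S κ ρ w m k),
      Χ (OnePair.jAway S κ ρ w m k y) = awayLevelChar S ρ ePk hμPk hadd₁Pk hadd₂Pk hgalPk κ w I x σ m k y := by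
  -- the directed system over `ℕ × ℕ` from the floor `n₀ = nfl w`
  let D : ℕ × ℕ → Type := fun i ↦ OnePair.Dlev S κ ρ w (OnePair.nfl w + i.1) i.2
  let t : ∀ i i' : ℕ × ℕ, i ≤ i' → D i →+ D i' := fun i i' h ↦ OnePair.tAway S κ ρ w (Nat.add_le_add_left h.1 (OnePair.nfl w)) h.2
  let j : ∀ i : ℕ × ℕ, D i →+ OnePair.Dloc S κ ρ w := fun i ↦ OnePair.jAway S κ ρ w (OnePair.nfl w + i.1) i.2
  let χ : ∀ i : ℕ × ℕ, D i →+ AddCircle (1 : ℚ) := fun i ↦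
    awayLevelChar S ρ ePk hμPk hadd₁Pk hadd₂Pk hgalPk κ w I x σ (OnePair.nfl w + i.1) i.2
  have hjt : ∀ (i i' : ℕ × ℕ) (h : i ≤ i') (y : D i), j i' (t i i' h y) = j i y := fun i i' h y ↦
    OnePair.jAway_tAway S κ ρ w _ _ y
  have hχt : ∀ (i i' : ℕ × ℕ) (h : i ≤ i') (y : D i), χ i' (t i i' h y) = χ i y := fun i i' h y ↦
    awayLevelChar_tAway S ρ ePk hμPk hadd₁Pk hadd₂Pk hgalPk κ hκ w hw I hK x σ (Nat.le_add_right _ _) _ _ y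
  have hex : ∀ y : OnePair.Dloc S κ ρ w, ∃ (i : ℕ × ℕ) (y' : D i), j i y' = y := fun y ↦ by
    obtain ⟨n, hn, k, y', hy'⟩ := ProfiniteExhaustion.exists_jAway_eq_from S κ ρ w y
    obtain ⟨i, rfl⟩ := Nat.exists_eq_add_of_le hn
    exact ⟨(i, k), y', hy'⟩
  have hker : ∀ (i : ℕ × ℕ) (y : D i), j i y = 0 → ∃ (i' : ℕ × ℕ) (h : i ≤ i'), t i i' h y = 0 := fun i y hy ↦ by
    obtain ⟨m, hm, K, hK', e⟩ := OnePair.exists_tAway_eq_zero_of_jAway_eq_zero S κ ρ w y hy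
    obtain ⟨i', rfl⟩ := Nat.exists_eq_add_of_le ((Nat.le_add_right (OnePair.nfl w) i.1).trans hm)
    exact ⟨(i', K), ⟨Nat.le_of_add_le_add_left hm, hK'⟩, e⟩
  obtain ⟨Χ, hΧ⟩ := AwayKernel.exists_addMonoidHom_of_directed t j χ hjt hχt hex hker
  refine ⟨Χ, fun m hm k y ↦ ?_⟩
  obtain ⟨i, rfl⟩ := Nat.exists_eq_add_of_le hm
  exact hΧ (i, k) y

/-- **Uniqueness of the glued character** (exhaustion of `D_w` by the `j_{m,k}`, `m ≥ n_w`). [cite: SerreGaloisCohomology1997, I §2.2 Prop. 8] -/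
theorem awayCharacter_unique (x : I.H) (σ : absoluteGaloisGroup ℚ) {Χ Χ' : OnePair.Dloc S κ ρ w →+ AddCircle (1 : ℚ)}
    (hΧ : ∀ (m : ℕ), OnePair.nfl w ≤ m → ∀ (k : ℕ) (y : OnePair.Dlev S κ ρ w m k),
      Χ (OnePair.jAway S κ ρ w m k y) = awayLevelChar S ρ ePk hμPk hadd₁Pk hadd₂Pk hgalPk κ w I x σ m k y)
    (hΧ' : ∀ (m : ℕ), OnePair.nfl w ≤ m → ∀ (k : ℕ) (y : OnePair.Dlev S κ ρ w m k),
      Χ' (OnePair.jAway S κ ρ w m k y) = awayLevelChar S ρ ePk hμPk hadd₁Pk hadd₂Pk hgalPk κ w I x σ m k y) :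
    Χ = Χ' := by
  ext y
  obtain ⟨m, hm, k, y', rfl⟩ := ProfiniteExhaustion.exists_jAway_eq_from S κ ρ w y
  rw [hΧ m hm k y', hΧ' m hm k y']

set_option maxHeartbeats 800000 in
-- the dialect bridge `subgroupH1 U ↥A_ρ[2^k] = H1 (cofreeTorsionGaloisModule …) U` is slow to unify under `rw` (as in p696153 / p679036)
/-- **Additivity in `x`** of the level value characters (`proj`, `conj`, `red`, `⟨·, y⟩` and `t ↦ t.val • 2^{-k}` are additive).
[cite: Kato2004Asterisque, §13.8 (pp. 228–229)] -/
theorem awayLevelChar_add (x x' : I.H) (σ : absoluteGaloisGroup ℚ) (m k : ℕ) (y : OnePair.Dlev S κ ρ w m k) :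
    awayLevelChar S ρ ePk hμPk hadd₁Pk hadd₂Pk hgalPk κ w I (x + x') σ m k y =
      awayLevelChar S ρ ePk hμPk hadd₁Pk hadd₂Pk hgalPk κ w I x σ m k y + awayLevelChar S ρ ePk hμPk hadd₁Pk hadd₂Pk hgalPk κ w I x' σ m k y := by
  haveI : NeZero (2 ^ k) := ⟨pow_ne_zero k two_ne_zero⟩
  -- additivity of `red ∘ conj ∘ proj`
  have e : reduceH1CofreePkTorsion S ρ k (κ.layerSubgroup m)
        (conjMap (FramedGaloisRep.toGaloisRep ρ).toTopRep (κ.layerSubgroup m) σ 1 (I.proj m (x + x'))) =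
      reduceH1CofreePkTorsion S ρ k (κ.layerSubgroup m) (conjMap (FramedGaloisRep.toGaloisRep ρ).toTopRep (κ.layerSubgroup m) σ 1 (I.proj m x)) +
        reduceH1CofreePkTorsion S ρ k (κ.layerSubgroup m)
          (conjMap (FramedGaloisRep.toGaloisRep ρ).toTopRep (κ.layerSubgroup m) σ 1 (I.proj m x')) := by
    rw [(I.proj m).map_add, map_add, map_add]
  -- additivity of `⟨·, ·⟩_{m,2^k}` in the first argument (the sum is read in the `H1 (cofreeTorsionGaloisModule …)` dialect by `exact`)
  have e2 : layerPairingOf (cofreeTorsionGaloisModule S ρ ((2 ^ k : ℕ) : ℤ)) (2 ^ k) (ePk k) (hμPk k) (hadd₁Pk k) (hadd₂Pk k) (hgalPk k) κ w m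
        (reduceH1CofreePkTorsion S ρ k (κ.layerSubgroup m)
          (conjMap (FramedGaloisRep.toGaloisRep ρ).toTopRep (κ.layerSubgroup m) σ 1 (I.proj m (x + x')))) =
      layerPairingOf (cofreeTorsionGaloisModule S ρ ((2 ^ k : ℕ) : ℤ)) (2 ^ k) (ePk k) (hμPk k) (hadd₁Pk k) (hadd₂Pk k) (hgalPk k) κ w m
          (reduceH1CofreePkTorsion S ρ k (κ.layerSubgroup m)
            (conjMap (FramedGaloisRep.toGaloisRep ρ).toTopRep (κ.layerSubgroup m) σ 1 (I.proj m x))) +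
        layerPairingOf (cofreeTorsionGaloisModule S ρ ((2 ^ k : ℕ) : ℤ)) (2 ^ k) (ePk k) (hμPk k) (hadd₁Pk k) (hadd₂Pk k) (hgalPk k) κ w m
          (reduceH1CofreePkTorsion S ρ k (κ.layerSubgroup m)
            (conjMap (FramedGaloisRep.toGaloisRep ρ).toTopRep (κ.layerSubgroup m) σ 1 (I.proj m x'))) := by
    rw [e]
    exact map_add _ _ _
  rw [awayLevelChar_apply, awayLevelChar_apply, awayLevelChar_apply, e2]
  -- `(F + G) y = F y + G y` definitionally; no `rw` with a coercion-headed pattern (expensive `isDefEq` against the other coercions)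
  exact (congrArg (fun t : ZMod (2 ^ k) ↦ t.val • ((((2 : ℚ) ^ k)⁻¹ : ℚ) : AddCircle (1 : ℚ))) (AddMonoidHom.add_apply _ _ y)).trans
    (val_add_smul_of_nsmul_eq_zero _ (two_pow_nsmul_inv_two_pow k) _ _)

end Glue

end Summit.BirchSwinnertonDyer.BirchSwinnertonDyer.Theorems.ThetaTransport

end
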